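import Summits.AnomalousDissipation.AnomalousDissipation.Theses.LandauJetArena
import Literature.Analysis.FluidPDE.HomogeneousEulerProofs

/-!
# AnomalousDissipation / LandauJetArena — `NoConicalEulerFlux`: the flux does not depend on the cut-off

Route `AnomalousDissipation/LandauJetArena`, item stmt-AnomalousDissipation-1547
(`NoConicalEulerFlux`, support). The item's conclusion is the vanishing of the momentum flux
`Flux(χ) = ∫ (⟪U, ∇χ̃⟫ U + P ∇χ̃) dx`, `χ̃ = χ ∘ ‖·‖`, for EVERY smooth radial cut-off `χ`
(`χ = 1` on `r ≤ 1`, `χ = 0` on `r ≥ 2`). This helper file (`--supports`) records the part of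
the statement that IS a formal consequence of the weak Euler identity: `Flux(χ₁) = Flux(χ₂)` for
any two such cut-offs (`noConicalEulerFlux_cutoff_independent`), for fields that are merely
continuous off the origin — no homogeneity and no incompressibility are used. Indeed
`θ = χ̃₁ - χ̃₂` is smooth, supported in the shell `1 ≤ ‖x‖ ≤ 2`, so `Φ = θ c` is an admissible
test field for every constant vector `c`, and `⟪U, DΦ U⟫ + P div Φ = ⟪c, F_{χ₁} - F_{χ₂}⟫`
pointwise, whence `⟪c, Flux(χ₁) - Flux(χ₂)⟫ = 0` for all `c` (`flux_eq_of_sub_test`).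

So the item is equivalent to the vanishing of ONE vector `F(U, P) ∈ ℝ³` (the momentum flux of
the cone through any sphere); the refuters' remark "testing gives only r-independence of the
flux, not its vanishing" is exactly this lemma. What is NOT here: `F = 0` (the item; open at
`C⁰`, see the evidence note on the item) — only its `C¹` case is in the tree
(`LandauJetArenaNoConicalEulerFluxC1.lean`).
-/

-- `Summit.<Summit>.<Problem>` is the tree's mandated summit-side namespace (CONVENTIONS §2); for
-- this single-conjunct summit the two coincide, so the duplicate is deliberate.
set_option linter.dupNamespace false

noncomputable section

namespace Summit.AnomalousDissipation.AnomalousDissipation.Theorems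

open MeasureTheory Set Filter
open scoped InnerProductSpace RealInnerProductSpace Topology
open Literature.Analysis.FluidPDE

namespace NoConicalEulerFlux

/-! ### Smooth radial cut-offs `χ̃ = χ ∘ ‖·‖` -/

/-- A radial cut-off `χ ∘ ‖·‖` with `χ = 1` on `r ≤ 1` equals `1` near the origin. [folklore] -/
theorem radialCutoff_eventuallyEq_one {χ : ℝ → ℝ} (h1 : ∀ r, r ≤ 1 → χ r = 1) :
    (fun y : EuclideanSpace ℝ (Fin 3) => χ ‖y‖) =ᶠ[𝓝 0] fun _ => 1 := by
  filter_upwards [Metric.ball_mem_nhds (0 : EuclideanSpace ℝ (Fin 3)) one_pos] with z hz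
  rw [mem_ball_zero_iff] at hz
  exact h1 _ hz.le

/-- A smooth radial cut-off `χ ∘ ‖·‖` with `χ = 1` on `r ≤ 1` is smooth on `ℝ³` (the norm is
smooth off the origin, and the function is locally constant near it). [folklore] -/
theorem contDiff_radialCutoff {χ : ℝ → ℝ} (hχ : ContDiff ℝ (⊤ : ℕ∞) χ)
    (h1 : ∀ r, r ≤ 1 → χ r = 1) :
    ContDiff ℝ (⊤ : ℕ∞) (fun y : EuclideanSpace ℝ (Fin 3) => χ ‖y‖) := by
  rw [contDiff_iff_contDiffAt]
  intro y
  rcases eq_or_ne y 0 with rfl | hy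
  · exact (contDiffAt_const (c := (1 : ℝ))).congr_of_eventuallyEq
      (radialCutoff_eventuallyEq_one h1)
  · exact hχ.contDiffAt.comp y (contDiffAt_norm ℝ hy)

/-- The derivative of a radial cut-off vanishes near the origin. [folklore] -/
theorem fderiv_radialCutoff_eventuallyEq_zero {χ : ℝ → ℝ} (h1 : ∀ r, r ≤ 1 → χ r = 1) :
    fderiv ℝ (fun y : EuclideanSpace ℝ (Fin 3) => χ ‖y‖) =ᶠ[𝓝 0] 0 := by
  filter_upwards [eventually_eventually_nhds.mpr (radialCutoff_eventuallyEq_one h1)] with y hy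
  rw [Filter.EventuallyEq.fderiv_eq
    (hy : (fun y : EuclideanSpace ℝ (Fin 3) => χ ‖y‖) =ᶠ[𝓝 y] fun _ => 1)]
  simp

/-- The derivative of a radial cut-off with `χ = 0` on `r ≥ 2` vanishes outside the ball of
radius `2`. [folklore] -/
theorem fderiv_radialCutoff_eq_zero_of_two_lt {χ : ℝ → ℝ} (h2 : ∀ r, 2 ≤ r → χ r = 0)
    {y : EuclideanSpace ℝ (Fin 3)} (hy : 2 < ‖y‖) :
    fderiv ℝ (fun y : EuclideanSpace ℝ (Fin 3) => χ ‖y‖) y = 0 := by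
  have hev : (fun z : EuclideanSpace ℝ (Fin 3) => χ ‖z‖) =ᶠ[𝓝 y] fun _ => 0 := by
    have ho : IsOpen {z : EuclideanSpace ℝ (Fin 3) | 2 < ‖z‖} :=
      isOpen_lt continuous_const continuous_norm
    filter_upwards [ho.mem_nhds hy] with z hz
    exact h2 _ (le_of_lt hz)
  rw [hev.fderiv_eq]
  simp

/-! ### The flux integrand: integrability, and equality of fluxes from one test -/

variable {U : EuclideanSpace ℝ (Fin 3) → EuclideanSpace ℝ (Fin 3)} {P : EuclideanSpace ℝ (Fin 3) → ℝ}

/-- The momentum-flux integrand `⟪U, ∇q⟫ U + P ∇q` of a pair continuous off the origin is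
integrable when `q` is `C¹` with derivative vanishing near the origin and outside `‖x‖ ≤ 2`: it
is continuous (zero near `0`) with compact support. [folklore] -/
theorem integrable_fluxIntegrand (hU : ContinuousOn U {x | x ≠ 0})
    (hP : ContinuousOn P {x | x ≠ 0}) {q : EuclideanSpace ℝ (Fin 3) → ℝ} (hq : ContDiff ℝ 1 q)
    (hq0 : fderiv ℝ q =ᶠ[𝓝 0] 0)
    (hq2 : ∀ y : EuclideanSpace ℝ (Fin 3), 2 < ‖y‖ → fderiv ℝ q y = 0) :
    Integrable (fun x => ⟪U x, gradient q x⟫ • U x + P x • gradient q x) := by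
  have hgc : Continuous (gradient q) :=
    (InnerProductSpace.toDual ℝ (EuclideanSpace ℝ (Fin 3))).symm.continuous.comp
      (hq.continuous_fderiv one_ne_zero)
  have hg0 : gradient q =ᶠ[𝓝 0] 0 := by
    filter_upwards [hq0] with y hy
    show (InnerProductSpace.toDual ℝ (EuclideanSpace ℝ (Fin 3))).symm (fderiv ℝ q y) = 0
    rw [hy]
    simp
  have hg2 : ∀ y : EuclideanSpace ℝ (Fin 3), 2 < ‖y‖ → gradient q y = 0 := fun y hy => by
    show (InnerProductSpace.toDual ℝ (EuclideanSpace ℝ (Fin 3))).symm (fderiv ℝ q y) = 0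
    rw [hq2 y hy]
    simp
  have hc0 : ContinuousOn (fun x => ⟪U x, gradient q x⟫) {x : EuclideanSpace ℝ (Fin 3) | x ≠ 0} :=
    hU.inner hgc.continuousOn
  have hc1 : ContinuousOn (fun x => ⟪U x, gradient q x⟫ • U x)
      {x : EuclideanSpace ℝ (Fin 3) | x ≠ 0} := hc0.smul hU
  have hc2 : ContinuousOn (fun x => P x • gradient q x) {x : EuclideanSpace ℝ (Fin 3) | x ≠ 0} :=
    hP.smul hgc.continuousOn
  refine Continuous.integrable_of_hasCompactSupport ?_ ?_
  · refine Shvydkoy2018.continuous_of_off_origin (hc1.add hc2) ?_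
    filter_upwards [hg0] with y hy
    rw [Pi.zero_apply] at hy
    simp only [hy, Pi.zero_apply, inner_zero_right, zero_smul, smul_zero, add_zero]
  · refine HasCompactSupport.intro (isCompact_closedBall (0 : EuclideanSpace ℝ (Fin 3)) 2)
      fun y hy => ?_
    rw [Metric.mem_closedBall, dist_zero_right, not_le] at hy
    simp only [hg2 y hy, inner_zero_right, zero_smul, smul_zero, add_zero]

/-- **Two potentials whose difference is an admissible test give the same flux.** If `U`, `P`
satisfy the weak stationary Euler identity against smooth compactly supported fields vanishing
near the origin, `q₁`, `q₂` are smooth, `q₁ - q₂` vanishes near `0` and has compact support,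
and both flux integrands are integrable, then `∫ (⟪U, ∇q₁⟫ U + P ∇q₁) = ∫ (⟪U, ∇q₂⟫ U + P ∇q₂)`:
for each vector `c`, testing with `Φ = (q₁ - q₂) c` gives `⟪c, ∫ (F₁ - F₂)⟫ = 0`. [folklore] -/
theorem flux_eq_of_sub_test
    (hweak : ∀ Φ : EuclideanSpace ℝ (Fin 3) → EuclideanSpace ℝ (Fin 3), ContDiff ℝ (⊤ : ℕ∞) Φ →
      HasCompactSupport Φ → (0 : EuclideanSpace ℝ (Fin 3)) ∉ tsupport Φ →
      ∫ x, (⟪U x, fderiv ℝ Φ x (U x)⟫ + P x * VectorCalculus.divergence Φ x) = 0)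
    {q₁ q₂ : EuclideanSpace ℝ (Fin 3) → ℝ} (hs₁ : ContDiff ℝ (⊤ : ℕ∞) q₁)
    (hs₂ : ContDiff ℝ (⊤ : ℕ∞) q₂) (hz : (fun y => q₁ y - q₂ y) =ᶠ[𝓝 0] 0)
    (hc : HasCompactSupport (fun y => q₁ y - q₂ y))
    (hI₁ : Integrable (fun x => ⟪U x, gradient q₁ x⟫ • U x + P x • gradient q₁ x))
    (hI₂ : Integrable (fun x => ⟪U x, gradient q₂ x⟫ • U x + P x • gradient q₂ x)) :
    ∫ x, (⟪U x, gradient q₁ x⟫ • U x + P x • gradient q₁ x)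
      = ∫ x, (⟪U x, gradient q₂ x⟫ • U x + P x • gradient q₂ x) := by
  have hd₁ : Differentiable ℝ q₁ :=
    (hs₁.of_le (by exact_mod_cast le_top)).differentiable one_ne_zero
  have hd₂ : Differentiable ℝ q₂ :=
    (hs₂.of_le (by exact_mod_cast le_top)).differentiable one_ne_zero
  have hθs : ContDiff ℝ (⊤ : ℕ∞) (fun y => q₁ y - q₂ y) := hs₁.sub hs₂
  have hθ1 : ContDiff ℝ 1 (fun y => q₁ y - q₂ y) := hθs.of_le (by exact_mod_cast le_top)
  have hDθ : ∀ y, fderiv ℝ (fun y => q₁ y - q₂ y) y = fderiv ℝ q₁ y - fderiv ℝ q₂ y := fun y =>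
    fderiv_sub (hd₁ y) (hd₂ y)
  -- `⟪c, ∫ (F₁ - F₂)⟫ = 0` for every `c`, by testing with `Φ = θ c`
  have hzero : ∫ x, ((⟪U x, gradient q₁ x⟫ • U x + P x • gradient q₁ x)
      - (⟪U x, gradient q₂ x⟫ • U x + P x • gradient q₂ x)) = 0 := by
    refine integral_eq_zero_of_forall_integral_inner_eq_zero ℝ _ (hI₁.sub hI₂) fun c => ?_
    have hΦ : ContDiff ℝ (⊤ : ℕ∞) (fun y => (q₁ y - q₂ y) • c) := hθs.smul contDiff_const
    have hΦc : HasCompactSupport (fun y => (q₁ y - q₂ y) • c) := hc.smul_right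
    have hΦz : (fun y => (q₁ y - q₂ y) • c) =ᶠ[𝓝 (0 : EuclideanSpace ℝ (Fin 3))] 0 := by
      filter_upwards [hz] with y hy
      rw [Pi.zero_apply] at hy
      simp [hy]
    have hΦ0 : (0 : EuclideanSpace ℝ (Fin 3)) ∉ tsupport (fun y => (q₁ y - q₂ y) • c) :=
      notMem_tsupport_iff_eventuallyEq.mpr hΦz
    have hDΦ : ∀ y, fderiv ℝ (fun y => (q₁ y - q₂ y) • c) y
        = (fderiv ℝ (fun y => q₁ y - q₂ y) y).smulRight c := fun y =>
      ((hθ1.differentiable one_ne_zero y).hasFDerivAt.smul_const c).fderiv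
    have hdivΦ : ∀ y, VectorCalculus.divergence (fun y => (q₁ y - q₂ y) • c) y
        = fderiv ℝ (fun y => q₁ y - q₂ y) y c := by
      intro y
      rw [VectorCalculus.divergence, hDΦ y, ContinuousLinearMap.coe_smulRight,
        LinearMap.trace_smulRight]
      rfl
    have hw := hweak _ hΦ hΦc hΦ0
    simp_rw [hDΦ, hdivΦ, ContinuousLinearMap.smulRight_apply, inner_smul_right, hDθ] at hw
    rw [← hw]
    refine integral_congr_ae (Eventually.of_forall fun x => ?_)
    simp only [inner_sub_right, inner_add_right, inner_smul_right, sub_apply]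
    rw [real_inner_comm (gradient q₁ x) (U x), real_inner_comm (gradient q₂ x) (U x),
      real_inner_comm (gradient q₁ x) c, real_inner_comm (gradient q₂ x) c,
      real_inner_comm (U x) c]
    simp only [Shvydkoy2018.inner_gradient_left]
    ring
  rw [integral_sub hI₁ hI₂] at hzero
  exact sub_eq_zero.mp hzero

/-! ### Cut-off independence of the flux -/

/-- **The momentum flux of `NoConicalEulerFlux` does not depend on the cut-off.** Let
`U : ℝ³ → ℝ³`, `P : ℝ³ → ℝ` be continuous on `ℝ³ ∖ {0}` and satisfy the weak stationary Euler
identity `∫ (⟪U, DΦ U⟫ + P div Φ) = 0` for all smooth compactly supported `Φ` with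
`0 ∉ tsupport Φ`. Then for any two smooth radial cut-offs `χ₁, χ₂` (`= 1` on `r ≤ 1`, `= 0` on
`r ≥ 2`) the fluxes `∫ (⟪U, ∇χ̃ᵢ⟫ U + P ∇χ̃ᵢ)` coincide: test with `Φ = (χ̃₁ - χ̃₂) c`, which is
supported in the shell `1 ≤ ‖x‖ ≤ 2`. Neither homogeneity nor incompressibility is needed; this
is the formal ("r-independence") part of the item, whose remaining content is the vanishing of
the common value. [folklore] -/
theorem noConicalEulerFlux_cutoff_independent
    (hU : ContinuousOn U {x | x ≠ 0}) (hP : ContinuousOn P {x | x ≠ 0})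
    (hweak : ∀ Φ : EuclideanSpace ℝ (Fin 3) → EuclideanSpace ℝ (Fin 3), ContDiff ℝ (⊤ : ℕ∞) Φ →
      HasCompactSupport Φ → (0 : EuclideanSpace ℝ (Fin 3)) ∉ tsupport Φ →
      ∫ x, (⟪U x, fderiv ℝ Φ x (U x)⟫ + P x * VectorCalculus.divergence Φ x) = 0)
    {χ₁ χ₂ : ℝ → ℝ} (hχ₁ : ContDiff ℝ (⊤ : ℕ∞) χ₁) (h₁1 : ∀ r, r ≤ 1 → χ₁ r = 1)
    (h₁2 : ∀ r, 2 ≤ r → χ₁ r = 0) (hχ₂ : ContDiff ℝ (⊤ : ℕ∞) χ₂) (h₂1 : ∀ r, r ≤ 1 → χ₂ r = 1)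
    (h₂2 : ∀ r, 2 ≤ r → χ₂ r = 0) :
    ∫ x, (⟪U x, gradient (fun y : EuclideanSpace ℝ (Fin 3) => χ₁ ‖y‖) x⟫ • U x
        + P x • gradient (fun y : EuclideanSpace ℝ (Fin 3) => χ₁ ‖y‖) x)
      = ∫ x, (⟪U x, gradient (fun y : EuclideanSpace ℝ (Fin 3) => χ₂ ‖y‖) x⟫ • U x
        + P x • gradient (fun y : EuclideanSpace ℝ (Fin 3) => χ₂ ‖y‖) x) := by
  have hs₁ := contDiff_radialCutoff hχ₁ h₁1
  have hs₂ := contDiff_radialCutoff hχ₂ h₂1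
  refine flux_eq_of_sub_test hweak hs₁ hs₂ ?_ ?_
    (integrable_fluxIntegrand hU hP (hs₁.of_le (by exact_mod_cast le_top))
      (fderiv_radialCutoff_eventuallyEq_zero h₁1)
      (fun y hy => fderiv_radialCutoff_eq_zero_of_two_lt h₁2 hy))
    (integrable_fluxIntegrand hU hP (hs₂.of_le (by exact_mod_cast le_top))
      (fderiv_radialCutoff_eventuallyEq_zero h₂1)
      (fun y hy => fderiv_radialCutoff_eq_zero_of_two_lt h₂2 hy))
  · filter_upwards [radialCutoff_eventuallyEq_one (χ := χ₁) h₁1,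
      radialCutoff_eventuallyEq_one (χ := χ₂) h₂1] with y hy1 hy2
    rw [Pi.zero_apply, hy1, hy2, sub_self]
  · refine HasCompactSupport.intro (isCompact_closedBall (0 : EuclideanSpace ℝ (Fin 3)) 2)
      fun y hy => ?_
    rw [Metric.mem_closedBall, dist_zero_right, not_le] at hy
    rw [h₁2 _ hy.le, h₂2 _ hy.le, sub_self]

end NoConicalEulerFlux

end Summit.AnomalousDissipation.AnomalousDissipation.Theorems
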